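/-
Copyright (c) 2026 the pub-hodgecm-mathlib formalisation cell (harness21).  Prover seat hodgecm-mathlib-LH4-p14 (g6), req620 Track A «(D-RAM) FOUR-FRAME» squad, helper lane
on h413 = stmt-HodgeConjecture-24833 (count-neutral).  STAGE-1b VEHICLE brick (V6) — row (2) column in (R)-shape (coefficient producers over `hFamily`, heir LEAD T19-30 (3)).  2026-09-04.
-/
import Summits.HodgeConjecture.HodgeConjecture.Theorems.F0P3cDyRamHProfilesTypeTwoAffineWild   -- ★ p856125 (ρ2a): the type-(2) H-dictionary of `hFamily` (`Φ^st = ν_s·X + λ_s∕2`)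
import Summits.HodgeConjecture.HodgeConjecture.Theorems.F0P3cDyRamFourFrameHSideDefsR          -- ★ №2c-R: the row vocabulary (`finExplicitCollection`, `classOrbitalIntegral`, …)
import HarnessLib

/-!
# Crux `H413`, line LH4 «(D-RAM) FOUR-FRAME» — (V6) ROW (2) OF ANY TEST FUNCTION FOR `ψ := hFamily` FROM ONE TYPE-(2) G-SIDE IDENTITY IN (ρ2a)'s X-CURRENCY

Cell `hodgecm-mathlib` (D-0151), FLOOR 0, crux item H413 = `stmt-HodgeConjecture-24833`, route `HCCMUnconditional`; squad F0∕P3c∕LH4.  THEOREMS ONLY (no `def`, no instance, no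
notation, no `sorry`, default heartbeats); ★ `Theorems` imports only; lane `--supports stmt-HodgeConjecture-24833 --as helper`; COUNT-NEUTRAL (`hG` is a HYPOTHESIS — the
type-(2) census of the piece; nothing asserted).

WHY.  ROW (2) (type-(2) population: `γ_H.1` with NO eigenvalue in `L_w`) of the open tier-0 rows asks near `1` for `Σᶠ_c Δ‴_v[μ](γ_H, out c)·Φ(c, g) = Σ_s coef_s·Φ^st(γ_H, ψ_s)` with
the SAME `(ψ, coef)` as rows (1)(3); by (R) (heir LEAD T19-30 (3)) `ψ := hFamily`, `coef` = the vector row (1) fixes (★ p859018 ∕ ★ p859212).  ★ (ρ2a) p856125 puts the H-side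
on that population in closed form through ONE number `X(γ_H)` (fixed vertices on the `SL₂(L⁺_v)`-tree): `Φ^st(γ_H, hFamily s) = ν_s·X + λ_s∕2`.  Hence row (2) of ANY `G′_v`-test
function `F` (a frozen piece `gselStar j …`, a congruence-profile indicator, …) for `(hFamily, coef)` follows from ONE G-side identity in X-currency —
`Σᶠ_c Δ‴·Φ(c, F) = (Σ_s coef_s ν_s)·X + (Σ_s coef_s λ_s)∕2` — which is exactly what the piece's TYPE-(2) CENSUS must deliver (the (ρ2b)∕(ρ2b′-X) road of ★ p858565, re-run for
the piece; LH4-p07 (g8) row-(2) lead).  At `coefAffine(cA, cB)` the target is `(cA∕2)·X + cB∕2` — (R) predicts the SAME constants as row (1).  This is ★ p856034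
`rowTwo_coefStar_of_hProfiles_affine_of_gSide` with `coef* ↦` any `coef` and `1_{K_t} ↦` any `F`.
HONEST LABEL.  Count-neutral; pays no registered stub, touches no `Lines/` module; `HC_CM` is proved only modulo the 7 printed citations (2 remaining named inputs: hLiu418 =
`stmt-HodgeConjecture-24832`, h413 = `stmt-HodgeConjecture-24833`) until rung 0 closes.

## References
* [Rogawski1990] J. D. Rogawski, *Automorphic Representations of Unitary Groups in Three Variables*, Ann. of Math. Stud. 123 (1990): §4.9 Prop. 4.9.1 (b) p. 55, Lemma 4.9.3 p. 56; §4.3 (4.3.1) p. 43.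
* [Kottwitz1988] R. E. Kottwitz, *Tamagawa numbers*, Ann. of Math. 127 (1988), §2.
-/

set_option autoImplicit false

noncomputable section

namespace Summit.HodgeConjecture.HodgeConjecture.Cruxes.H413.F0P3cDyRamPieceTypeTwoRowVehicle

open MeasureTheory Measure NumberField IsDedekindDomain Topology Filter
open Literature.NumberTheory.Automorphic Literature.NumberTheory.Automorphic.UnitaryGroup Literature.NumberTheory.Automorphic.IntegralReduction
open Literature.NumberTheory.Automorphic.UnitaryLatticeTree Literature.NumberTheory.Automorphic.HermitianLattice
open Literature.NumberTheory.Rogawski1990 Literature.NumberTheory.GaloisRepresentations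
open scoped Matrix MatrixGroups Classical ValuativeRel WithZero
open Literature.NumberTheory.Automorphic.UnitaryThreeFourFrame
open Summit.HodgeConjecture.HodgeConjecture.Cruxes.H413.F0P3cDyRamFourFrameHFamilyDefs
open Summit.HodgeConjecture.HodgeConjecture.Cruxes.H413.F0P3cDyRamHProfilesTypeTwoAffineWild

/-- **(V6) `rowTwo_of_gSide_hFamily` — ROW (2) OF ANY TEST FUNCTION `F` ON `G′_v` FOR `ψ := hFamily` FROM ONE TYPE-(2) `G`-SIDE IDENTITY IN ★ (ρ2a)'s CURRENCY.**
★ (ρ2a) `hProfiles_typeTwo_affine_wild`: near `1`, at every `G`-regular type-(2) `γ_H` (no `w`-eigenvalue in `L_w`) there is `X ∈ ℂ` (the fixed-vertex count of `γ_H` on the `SL₂`-tree)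
with `Φ^st(γ_H, hFamily s) = ν_s·X + λ_s∕2`, `λ_{s_V} = 0`, `λ_s = −2ν_s` (`s ≠ s_V = d mod 2`).  HENCE for ANY `coef : Fin 2 → ℂ`: IF the G-side of `F` satisfies, near `1` on the type-(2)
population, for every such `X`, `Σᶠ_c Δ‴_v[μ](γ_H, out c)·Φ(c, F) = (coef 0·ν_0 + coef 1·ν_1)·X + (coef 0·λ_0 + coef 1·λ_1)∕2` (hypothesis `hG` — the piece's TYPE-(2) CENSUS in X-currency, the
(ρ2b) content; at ★ p859018's `coefAffine(cA, cB)` the target reads `(cA∕2)·X + cB∕2`), THEN the ROW-(2) conjunct of the rows socket holds for `(hFamily, coef)`: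
`Σᶠ_c Δ‴(γ_H, out c)·Φ(c, F) = Σ_s coef_s·Φ^st(γ_H, hFamily s)`.  (= ★ p856034 `rowTwo_coefStar_of_hProfiles_affine_of_gSide` with `coef*` ↦ any `coef`, `1_{K_t}` ↦ any `F`.)
[cite: Rogawski1990, §4.9 Prop. 4.9.1 (b) p. 55, Lemma 4.9.3 p. 56; §4.3 (4.3.1) p. 43] [cite: Kottwitz1988, §2] -/
theorem rowTwo_of_gSide_hFamily
    (L : Type) [Field L] [NumberField L] [IsCMField L]
      {v : HeightOneSpectrum (𝓞 ↥(maximalRealSubfield L))} (w : UnitaryGroup.PlacesOver L v)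
      (hw : IsCMField.complexConj L • w.1 = w.1) (_he : v.asIdeal.ramificationIdx' w.1.asIdeal ≠ 1)
      (_h2 : ¬ IsUnit (2 : 𝒪[w.1.adicCompletion L]))
      (ϖ : (w.1.adicCompletion L)) (_hϖ : Valued.v ϖ = WithZero.exp (-1 : ℤ)) (d tE : ℕ) (_hD : IsRamifiedQuadraticDatum (galAdicCompletionMap (L := L) (IsCMField.complexConj L) hw) ϖ d tE)
      [Fintype (Valued.ResidueField (w.1.adicCompletion L))]
      (μ : HeckeCharacter L)
      [MeasurableSpace ((UnitaryGroup.cmDatum L 3 (Matrix.of fun i j : Fin 3 => if i.val + j.val + 1 = 3 then (1 : L) else 0)).Local v)] [BorelSpace ((UnitaryGroup.cmDatum L 3 (Matrix.of fun i j : Fin 3 => if i.val + j.val + 1 = 3 then (1 : L) else 0)).Local v)]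
      [∀ γ : ((UnitaryGroup.cmDatum L 3 (Matrix.of fun i j : Fin 3 => if i.val + j.val + 1 = 3 then (1 : L) else 0)).Local v), MeasurableSpace (((UnitaryGroup.cmDatum L 3 (Matrix.of fun i j : Fin 3 => if i.val + j.val + 1 = 3 then (1 : L) else 0)).Local v) ⧸ Subgroup.centralizer ({γ} : Set ((UnitaryGroup.cmDatum L 3 (Matrix.of fun i j : Fin 3 => if i.val + j.val + 1 = 3 then (1 : L) else 0)).Local v)))]
      [∀ γ : ((UnitaryGroup.cmDatum L 3 (Matrix.of fun i j : Fin 3 => if i.val + j.val + 1 = 3 then (1 : L) else 0)).Local v), BorelSpace (((UnitaryGroup.cmDatum L 3 (Matrix.of fun i j : Fin 3 => if i.val + j.val + 1 = 3 then (1 : L) else 0)).Local v) ⧸ Subgroup.centralizer ({γ} : Set ((UnitaryGroup.cmDatum L 3 (Matrix.of fun i j : Fin 3 => if i.val + j.val + 1 = 3 then (1 : L) else 0)).Local v)))]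
      [MeasurableSpace ((UnitaryGroup.cmDatum L 2 (Matrix.of fun i j : Fin 2 => if i.val + j.val + 1 = 2 then (1 : L) else 0)).Local v × (UnitaryGroup.cmDatum L 1 (Matrix.of fun i j : Fin 1 => if i.val + j.val + 1 = 1 then (1 : L) else 0)).Local v)] [BorelSpace ((UnitaryGroup.cmDatum L 2 (Matrix.of fun i j : Fin 2 => if i.val + j.val + 1 = 2 then (1 : L) else 0)).Local v × (UnitaryGroup.cmDatum L 1 (Matrix.of fun i j : Fin 1 => if i.val + j.val + 1 = 1 then (1 : L) else 0)).Local v)]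
      [∀ a : ((UnitaryGroup.cmDatum L 2 (Matrix.of fun i j : Fin 2 => if i.val + j.val + 1 = 2 then (1 : L) else 0)).Local v × (UnitaryGroup.cmDatum L 1 (Matrix.of fun i j : Fin 1 => if i.val + j.val + 1 = 1 then (1 : L) else 0)).Local v), MeasurableSpace (((UnitaryGroup.cmDatum L 2 (Matrix.of fun i j : Fin 2 => if i.val + j.val + 1 = 2 then (1 : L) else 0)).Local v × (UnitaryGroup.cmDatum L 1 (Matrix.of fun i j : Fin 1 => if i.val + j.val + 1 = 1 then (1 : L) else 0)).Local v) ⧸ Subgroup.centralizer ({a} : Set ((UnitaryGroup.cmDatum L 2 (Matrix.of fun i j : Fin 2 => if i.val + j.val + 1 = 2 then (1 : L) else 0)).Local v × (UnitaryGroup.cmDatum L 1 (Matrix.of fun i j : Fin 1 => if i.val + j.val + 1 = 1 then (1 : L) else 0)).Local v)))]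
      [∀ a : ((UnitaryGroup.cmDatum L 2 (Matrix.of fun i j : Fin 2 => if i.val + j.val + 1 = 2 then (1 : L) else 0)).Local v × (UnitaryGroup.cmDatum L 1 (Matrix.of fun i j : Fin 1 => if i.val + j.val + 1 = 1 then (1 : L) else 0)).Local v), BorelSpace (((UnitaryGroup.cmDatum L 2 (Matrix.of fun i j : Fin 2 => if i.val + j.val + 1 = 2 then (1 : L) else 0)).Local v × (UnitaryGroup.cmDatum L 1 (Matrix.of fun i j : Fin 1 => if i.val + j.val + 1 = 1 then (1 : L) else 0)).Local v) ⧸ Subgroup.centralizer ({a} : Set ((UnitaryGroup.cmDatum L 2 (Matrix.of fun i j : Fin 2 => if i.val + j.val + 1 = 2 then (1 : L) else 0)).Local v × (UnitaryGroup.cmDatum L 1 (Matrix.of fun i j : Fin 1 => if i.val + j.val + 1 = 1 then (1 : L) else 0)).Local v)))]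
      (νH : Measure ((UnitaryGroup.cmDatum L 2 (Matrix.of fun i j : Fin 2 => if i.val + j.val + 1 = 2 then (1 : L) else 0)).Local v × (UnitaryGroup.cmDatum L 1 (Matrix.of fun i j : Fin 1 => if i.val + j.val + 1 = 1 then (1 : L) else 0)).Local v)) [νH.IsHaarMeasure] [νH.IsMulRightInvariant]
      (mH : OrbitalMeasureFamily ((UnitaryGroup.cmDatum L 2 (Matrix.of fun i j : Fin 2 => if i.val + j.val + 1 = 2 then (1 : L) else 0)).Local v × (UnitaryGroup.cmDatum L 1 (Matrix.of fun i j : Fin 1 => if i.val + j.val + 1 = 1 then (1 : L) else 0)).Local v)) (mG₃ : OrbitalMeasureFamily ((UnitaryGroup.cmDatum L 3 (Matrix.of fun i j : Fin 3 => if i.val + j.val + 1 = 3 then (1 : L) else 0)).Local v))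
      (hmH : mH.IsCanonical (IsLocalGRegular L v) νH)
      (F : ((UnitaryGroup.cmDatum L 3 (Matrix.of fun i j : Fin 3 => if i.val + j.val + 1 = 3 then (1 : L) else 0)).Local v) → ℂ) (coef : Fin 2 → ℂ)
      (hG : ∃ V ∈ 𝓝 (1 : ((UnitaryGroup.cmDatum L 2 (Matrix.of fun i j : Fin 2 => if i.val + j.val + 1 = 2 then (1 : L) else 0)).Local v × (UnitaryGroup.cmDatum L 1 (Matrix.of fun i j : Fin 1 => if i.val + j.val + 1 = 1 then (1 : L) else 0)).Local v)), ∀ γH ∈ V, IsLocalGRegular L v γH →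
        ¬ (∃ x : (w.1.adicCompletion L), (((((γH).1.val : GL (Fin 2) (UnitaryGroup.LocalRing L v)).val.map (Pi.evalRingHom (fun w' : UnitaryGroup.PlacesOver L v => w'.1.adicCompletion L) w))).charpoly).IsRoot x) →
        ∀ X : ℂ, (∀ s : Fin 2, stableOrbitalIntegralRel (IsLocalStablyConjH L v) mH (hFamily L w hw ϖ s) γH = (νH.real (Function.support (hFamily L w hw ϖ s)) : ℂ) * X + (if ((s : Fin 2) : ℕ) = d % 2 then (0 : ℂ) else -2 * (νH.real (Function.support (hFamily L w hw ϖ s)) : ℂ)) / 2) →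
          ∑ᶠ c : ConjClasses ((UnitaryGroup.cmDatum L 3 (Matrix.of fun i j : Fin 3 => if i.val + j.val + 1 = 3 then (1 : L) else 0)).Local v), ((finExplicitCollection L (Matrix.of fun i j : Fin 3 => if i.val + j.val + 1 = 3 then (1 : L) else 0) μ (finExplicitDelta_conj_left_all L (Matrix.of fun i j : Fin 3 => if i.val + j.val + 1 = 3 then (1 : L) else 0) μ) (finExplicitDelta_conj_right_all L (Matrix.of fun i j : Fin 3 => if i.val + j.val + 1 = 3 then (1 : L) else 0) μ)) v).Δ γH (Quotient.out c) * classOrbitalIntegral mG₃ F c =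
            (coef 0 * (νH.real (Function.support (hFamily L w hw ϖ 0)) : ℂ) + coef 1 * (νH.real (Function.support (hFamily L w hw ϖ 1)) : ℂ)) * X + (coef 0 * (if ((0 : Fin 2) : ℕ) = d % 2 then (0 : ℂ) else -2 * (νH.real (Function.support (hFamily L w hw ϖ 0)) : ℂ)) + coef 1 * (if ((1 : Fin 2) : ℕ) = d % 2 then (0 : ℂ) else -2 * (νH.real (Function.support (hFamily L w hw ϖ 1)) : ℂ))) / 2) :
    ∃ V ∈ 𝓝 (1 : ((UnitaryGroup.cmDatum L 2 (Matrix.of fun i j : Fin 2 => if i.val + j.val + 1 = 2 then (1 : L) else 0)).Local v × (UnitaryGroup.cmDatum L 1 (Matrix.of fun i j : Fin 1 => if i.val + j.val + 1 = 1 then (1 : L) else 0)).Local v)), ∀ γH ∈ V, IsLocalGRegular L v γH →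
      ¬ (∃ x : (w.1.adicCompletion L), (((((γH).1.val : GL (Fin 2) (UnitaryGroup.LocalRing L v)).val.map (Pi.evalRingHom (fun w' : UnitaryGroup.PlacesOver L v => w'.1.adicCompletion L) w))).charpoly).IsRoot x) →
      ∑ᶠ c : ConjClasses ((UnitaryGroup.cmDatum L 3 (Matrix.of fun i j : Fin 3 => if i.val + j.val + 1 = 3 then (1 : L) else 0)).Local v), ((finExplicitCollection L (Matrix.of fun i j : Fin 3 => if i.val + j.val + 1 = 3 then (1 : L) else 0) μ (finExplicitDelta_conj_left_all L (Matrix.of fun i j : Fin 3 => if i.val + j.val + 1 = 3 then (1 : L) else 0) μ) (finExplicitDelta_conj_right_all L (Matrix.of fun i j : Fin 3 => if i.val + j.val + 1 = 3 then (1 : L) else 0) μ)) v).Δ γH (Quotient.out c) * classOrbitalIntegral mG₃ F c =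
        ∑ s, coef s * stableOrbitalIntegralRel (IsLocalStablyConjH L v) mH (hFamily L w hw ϖ s) γH := by
  obtain ⟨V₁, hV₁, h₁⟩ := hProfiles_typeTwo_affine_wild L w hw _he _h2 ϖ _hϖ d tE _hD νH mH hmH
  obtain ⟨V₂, hV₂, h₂⟩ := hG
  refine ⟨V₁ ∩ V₂, Filter.inter_mem hV₁ hV₂, fun γH hγ hreg hnr => ?_⟩
  obtain ⟨X, hX⟩ := h₁ γH hγ.1 hreg hnr
  rw [h₂ γH hγ.2 hreg hnr X hX, Fin.sum_univ_two, hX 0, hX 1]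
  ring

end Summit.HodgeConjecture.HodgeConjecture.Cruxes.H413.F0P3cDyRamPieceTypeTwoRowVehicle

end
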